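import Summits.RiemannHypothesis.RiemannHypothesis.Theorems.Splittings.ScrewBlaschkeFactors

/-!
# Blaschke–Borel rigidity: an `ℓ¹` Borel series with Blaschke poles cannot be continued across the circle

Cell `rh-split`, seat `rh-split-screw-bridge` gen 17; card `cards/SPLIT-screw-bridge.md` §22 (census V117′).
ζ-free and RH-free: pure complex analysis.

THE LEMMA (`cluster_charge_eq_zero`).  Let `w : ι → ℂ` be points of the open unit disc satisfying the
BLASCHKE condition `Σ (1 - ‖w i‖) < ∞`, let `b : ι → ℂ` be absolutely summable charges, and suppose the
Borel series `z ↦ Σ b i / (z - w i)` — which converges on `1 < ‖z‖` — agrees there with `g - c₀` for a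
function `g` holomorphic on the larger region `ρ₀ < ‖z‖`.  Then for every point `a` with
`ρ₀ < ‖a‖ < 1` the total charge sitting at `a` vanishes: `Σ_{i : w i = a} b i = 0`.
In words: the outside function of an `ℓ¹` Borel series with Blaschke poles cannot be continued
analytically inward past any pole carrying non-zero total charge.  (For non-Blaschke pole sets this
fails — Brown–Shields–Zeller / Wolff: the outside function may even vanish identically; that is the
mechanism of the blind configurations B16/B16′.)

PROOF (elementary — no boundary values, no Hardy spaces, no infinite Blaschke products).  Pair both
sides against the test functions `φ(z) = z^N · Π_{i ∈ F} bl (w i) z` (monomial times a FINITE Blaschke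
product): Cauchy's formula on a circle `‖z‖ = R' > 1` and uniform convergence give
`Σ b i φ(w i) = (2πi)⁻¹ ∮_{‖z‖=R'} φ (g - c₀)`; Cauchy–Goursat on the annulus moves the circle down to
`‖z‖ = r₁ ∈ (ρ₀, ‖a‖)`, where `|φ| ≤ r₁^N`; on the left, `Π bl` kills the charges indexed by `F`, is
bounded by `1` at every pole, and is bounded BELOW at `a`, uniformly in `F`, by the Blaschke condition.
Hence `c ‖a‖^N |Σ_{w i = a} b i| ≤ r₁^{N+1} M + (tail of Σ|b i|)`, and `N → ∞` with `r₁ < ‖a‖` forces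
the cluster charge to vanish.

USE (T-BL, card §22 (2) steps S5–S7): with `w_ρ = r*/p_ρ`, `b_ρ = c_ρ r*/(2 p_ρ)`, `g(w) = H(r*/w)`,
`ρ₀ = e^{-δh}`, the lemma gives `Σ_{ρ ↦ p} c_ρ = 0` for every top-layer pole `p`, contradicting
`Re c_ρ < 0`.  Nothing here bears on the truth of RH.
-/

noncomputable section

set_option linter.dupNamespace false

open Complex Metric Set Filter Topology
open scoped Real ComplexConjugate

namespace Summit.RiemannHypothesis.RiemannHypothesis.Theorems.Splittings.ScrewBlaschkeRigidity
/-! ## 3. The Cauchy pairing -/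

/-- For `φ = phi w F N` and `ρ₀ < r₁ < 1`: `Σ b i φ(w i) = (2πi)⁻¹ ∮_{‖z‖ = r₁} φ · G`, where `G`
is holomorphic on `ρ₀ < ‖z‖` and equals the Borel series `Σ b i / (z - w i)` on `1 < ‖z‖`. -/
theorem pairing_identity {ι : Type*} [Countable ι] {w b : ι → ℂ} {ρ₀ : ℝ} {G : ℂ → ℂ}
    (hρ₀ : 0 ≤ ρ₀) (hw : ∀ i, ‖w i‖ < 1) (hb : Summable fun i ↦ ‖b i‖)
    (hGat : ∀ z : ℂ, ρ₀ < ‖z‖ → DifferentiableAt ℂ G z)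
    (heq : ∀ z : ℂ, 1 < ‖z‖ → HasSum (fun i ↦ b i / (z - w i)) (G z))
    (F : Finset ι) (N : ℕ) {r₁ : ℝ} (hr₁ρ : ρ₀ < r₁) (hr₁1 : r₁ < 1) :
    ∑' i, b i * phi w F N (w i) = (2 * π * I)⁻¹ • ∮ z in C(0, r₁), phi w F N z * G z := by
  classical
  have hr₁0 : 0 < r₁ := lt_of_le_of_lt hρ₀ hr₁ρ
  set φ : ℂ → ℂ := phi w F N with hφ
  -- a bound `m < 1` for `‖w i‖` on `F`, and the outer radius `R' = 2 / (1 + m)`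
  obtain ⟨m, hm0, hm1, hm⟩ : ∃ m : ℝ, 0 ≤ m ∧ m < 1 ∧ ∀ i ∈ F, ‖w i‖ ≤ m := by
    rcases F.eq_empty_or_nonempty with hF | hF
    · exact ⟨0, le_rfl, one_pos, by simp [hF]⟩
    · obtain ⟨j, _, hmax⟩ := F.exists_max_image (fun i ↦ ‖w i‖) hF
      exact ⟨‖w j‖, norm_nonneg _, hw j, hmax⟩
  set R' : ℝ := 2 / (1 + m) with hR'
  have h1m : 0 < 1 + m := by linarith
  have hR'1 : 1 < R' := by rw [hR', lt_div_iff₀ h1m]; linarith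
  have hR'0 : 0 < R' := one_pos.trans hR'1
  have hmR' : m * R' < 1 := by
    rw [hR', ← mul_div_assoc, div_lt_one h1m]; linarith
  -- differentiability of `φ` on the closed disc `‖z‖ ≤ R'`
  have hφd : ∀ z : ℂ, ‖z‖ ≤ R' → DifferentiableAt ℂ φ z := fun z hz ↦
    differentiableAt_phi fun i hi ↦ by
      calc ‖w i‖ * ‖z‖ ≤ m * R' := mul_le_mul (hm i hi) hz (norm_nonneg _) hm0
        _ < 1 := hmR'
  have hφc : ContinuousOn φ (closedBall (0 : ℂ) R') := fun z hz ↦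
    (hφd z (by simpa using hz)).continuousAt.continuousWithinAt
  have hsph : ∀ z ∈ sphere (0 : ℂ) R', ‖z‖ = R' := fun z hz ↦ by simpa using hz
  -- STEP 1: each pole term, by Cauchy's integral formula on `‖z‖ = R'`
  have hterm : ∀ i, (∮ z in C(0, R'), φ z * (b i / (z - w i)))
      = (2 * π * I) * (b i * φ (w i)) := by
    intro i
    have hwi : w i ∈ ball (0 : ℂ) R' := by
      rw [mem_ball_zero_iff]; exact (hw i).trans hR'1
    have hC := Complex.two_pi_I_inv_smul_circleIntegral_sub_inv_smul_of_differentiable_on_off_countable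
      countable_empty hwi hφc (fun z hz ↦ hφd z (by
        have := hz.1; rw [mem_ball_zero_iff] at this; exact this.le))
    rw [inv_smul_eq_iff₀ (by simp [Real.pi_ne_zero, I_ne_zero] : (2 * π * I : ℂ) ≠ 0)] at hC
    have hfun : (fun z ↦ φ z * (b i / (z - w i))) = fun z ↦ b i • ((z - w i)⁻¹ • φ z) := by
      funext z; simp only [smul_eq_mul]; ring
    rw [hfun, circleIntegral.integral_smul, hC, smul_eq_mul, smul_eq_mul]
    ring
  -- STEP 2: partial sums are circle integrals
  have hcont_term : ∀ i, ContinuousOn (fun z ↦ φ z * (b i / (z - w i))) (sphere (0 : ℂ) R') := by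
    intro i z hz
    have hz' : ‖z‖ = R' := hsph z hz
    have hne : z - w i ≠ 0 := by
      intro h0
      have : ‖z‖ = ‖w i‖ := by rw [sub_eq_zero.1 h0]
      linarith [hw i]
    have hd : DifferentiableAt ℂ (fun y ↦ φ y * (b i / (y - w i))) z :=
      (hφd z hz'.le).mul ((differentiableAt_const (b i)).div
        (differentiableAt_id.sub_const (w i)) hne)
    exact hd.continuousAt.continuousWithinAt
  have hci : ∀ i, CircleIntegrable (fun z ↦ φ z * (b i / (z - w i))) 0 R' := fun i ↦
    (hcont_term i).circleIntegrable hR'0.le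
  have hpartial : ∀ T : Finset ι,
      (∮ z in C(0, R'), φ z * ∑ i ∈ T, b i / (z - w i))
        = (2 * π * I) * ∑ i ∈ T, b i * φ (w i) := by
    intro T
    have h1 : (fun z ↦ φ z * ∑ i ∈ T, b i / (z - w i))
        = fun z ↦ ∑ i ∈ T, φ z * (b i / (z - w i)) := by
      funext z; rw [Finset.mul_sum]
    rw [h1, circleIntegral.integral_fun_sum (fun i _ ↦ hci i), Finset.mul_sum]
    exact Finset.sum_congr rfl fun i _ ↦ hterm i
  -- STEP 3: uniform convergence of the partial sums on the sphere `‖z‖ = R'`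
  obtain ⟨Φ, hΦ0, hΦ⟩ : ∃ Φ : ℝ, 0 ≤ Φ ∧ ∀ z ∈ sphere (0 : ℂ) R', ‖φ z‖ ≤ Φ := by
    obtain ⟨Φ, hΦ⟩ := (isCompact_sphere (0 : ℂ) R').exists_bound_of_continuousOn
      (hφc.mono sphere_subset_closedBall)
    exact ⟨max Φ 0, le_max_right _ _, fun z hz ↦ (hΦ z hz).trans (le_max_left _ _)⟩
  have htail : ∀ z ∈ sphere (0 : ℂ) R', ∀ T : Finset ι,
      ‖φ z * G z - φ z * ∑ i ∈ T, b i / (z - w i)‖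
        ≤ Φ * ((∑' i : {x // x ∉ T}, ‖b i‖) / (R' - 1)) := by
    intro z hz T
    have hz' : ‖z‖ = R' := hsph z hz
    have hs := heq z (by rw [hz']; exact hR'1)
    have hden : ∀ i, R' - 1 ≤ ‖z - w i‖ := fun i ↦ by
      have := norm_sub_norm_le z (w i)
      linarith [hw i]
    have hbd : ∀ i, ‖b i / (z - w i)‖ ≤ ‖b i‖ / (R' - 1) := fun i ↦ by
      rw [norm_div]
      exact div_le_div_of_nonneg_left (norm_nonneg _) (by linarith) (hden i)
    have hsn : Summable fun i ↦ ‖b i / (z - w i)‖ :=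
      (hb.div_const (R' - 1)).of_nonneg_of_le (fun i ↦ norm_nonneg _) hbd
    have hrest : G z - ∑ i ∈ T, b i / (z - w i) = ∑' i : {x // x ∉ T}, b i / (z - w i) := by
      have := hs.summable.sum_add_tsum_compl (s := T)
      rw [hs.tsum_eq] at this
      exact (eq_sub_of_add_eq' this).symm
    rw [← mul_sub, norm_mul, hrest]
    refine mul_le_mul (hΦ z hz) ?_ (norm_nonneg _) hΦ0
    calc ‖∑' i : {x // x ∉ T}, b i / (z - w i)‖
        ≤ ∑' i : {x // x ∉ T}, ‖b i / (z - w i)‖ := norm_tsum_le_tsum_norm (hsn.subtype _)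
      _ ≤ ∑' i : {x // x ∉ T}, ‖b i‖ / (R' - 1) :=
          (hsn.subtype _).tsum_le_tsum (fun i ↦ hbd i) ((hb.div_const _).subtype _)
      _ = (∑' i : {x // x ∉ T}, ‖b i‖) / (R' - 1) := tsum_div_const
  have hunif : TendstoUniformlyOn (fun (T : Finset ι) z ↦ φ z * ∑ i ∈ T, b i / (z - w i))
      (fun z ↦ φ z * G z) atTop (sphere (0 : ℂ) R') := by
    rw [Metric.tendstoUniformlyOn_iff]
    intro ε hε
    have hR1 : 0 < R' - 1 := by linarith
    have hsmall : ∀ᶠ T : Finset ι in atTop,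
        (∑' i : {x // x ∉ T}, ‖b i‖) < ε * (R' - 1) / (Φ + 1) :=
      (tendsto_tsum_compl_atTop_zero (fun i ↦ ‖b i‖)).eventually
        (gt_mem_nhds (by positivity))
    refine hsmall.mono fun T hT z hz ↦ ?_
    rw [dist_eq_norm]
    have hΦ1 : Φ / (Φ + 1) < 1 := by rw [div_lt_one (by linarith)]; linarith
    calc ‖φ z * G z - φ z * ∑ i ∈ T, b i / (z - w i)‖
        ≤ Φ * ((∑' i : {x // x ∉ T}, ‖b i‖) / (R' - 1)) := htail z hz T
      _ ≤ Φ * ((ε * (R' - 1) / (Φ + 1)) / (R' - 1)) := by gcongr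
      _ = ε * (Φ / (Φ + 1)) := by field_simp
      _ < ε := by nlinarith
  -- STEP 4: pass to the limit: `HasSum (b i φ(w i)) ((2πi)⁻¹ ∮_{R'} φ G)`
  have hcont : ∀ᶠ T : Finset ι in atTop,
      ContinuousOn (fun z ↦ φ z * ∑ i ∈ T, b i / (z - w i)) (sphere (0 : ℂ) R') := by
    refine Eventually.of_forall fun T ↦ ?_
    have h1 : (fun z ↦ φ z * ∑ i ∈ T, b i / (z - w i))
        = fun z ↦ ∑ i ∈ T, φ z * (b i / (z - w i)) := by
      funext z; rw [Finset.mul_sum]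
    rw [h1]
    exact continuousOn_finsetSum T fun i _ ↦ hcont_term i
  have hlim := hunif.tendsto_circleIntegral_of_continuousOn hR'0.le hcont
  have h2pi : (2 * π * I : ℂ) ≠ 0 := by simp [Real.pi_ne_zero, I_ne_zero]
  have hHas : HasSum (fun i ↦ b i * φ (w i))
      ((2 * π * I)⁻¹ • ∮ z in C(0, R'), φ z * G z) := by
    have hlim' : Tendsto (fun T : Finset ι ↦ (2 * π * I)⁻¹ * ∮ z in C(0, R'),
        φ z * ∑ i ∈ T, b i / (z - w i)) atTop
        (𝓝 ((2 * π * I)⁻¹ * ∮ z in C(0, R'), φ z * G z)) :=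
      hlim.const_mul _
    have hfun : (fun T : Finset ι ↦ (2 * π * I)⁻¹ * ∮ z in C(0, R'),
        φ z * ∑ i ∈ T, b i / (z - w i)) = fun T ↦ ∑ i ∈ T, b i * φ (w i) := by
      funext T
      rw [hpartial T, ← mul_assoc, inv_mul_cancel₀ h2pi, one_mul]
    rw [hfun] at hlim'
    rw [smul_eq_mul]
    exact hlim'
  -- STEP 5: move the circle from `R'` down to `r₁` (Cauchy–Goursat on the annulus)
  have hann : (∮ z in C(0, R'), φ z * G z) = ∮ z in C(0, r₁), φ z * G z := by
    refine Complex.circleIntegral_eq_of_differentiable_on_annulus_off_countable hr₁0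
      (hr₁1.le.trans hR'1.le) countable_empty ?_ ?_
    · intro z hz
      have hzR : ‖z‖ ≤ R' := by
        have := hz.1; rw [mem_closedBall_zero_iff] at this; exact this
      have hzr : r₁ ≤ ‖z‖ := by
        have := hz.2; rw [mem_ball_zero_iff, not_lt] at this; exact this
      exact ((hφd z hzR).mul (hGat z (lt_of_lt_of_le hr₁ρ hzr))).continuousAt.continuousWithinAt
    · intro z hz
      have hz1 := hz.1
      have hzR : ‖z‖ ≤ R' := by
        have := hz1.1; rw [mem_ball_zero_iff] at this; exact this.le
      have hzr : r₁ < ‖z‖ := by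
        have := hz1.2; rw [mem_closedBall_zero_iff, not_le] at this; exact this
      exact (hφd z hzR).mul (hGat z (hr₁ρ.trans hzr))
  rw [hHas.tsum_eq, hann]

/-! ## 4. The rigidity theorem -/

/-- **Blaschke–Borel rigidity.**  If an `ℓ¹` Borel series with poles `w i` in the unit disc
satisfying the Blaschke condition agrees on `1 < ‖z‖` with `g - c₀`, `g` holomorphic on `ρ₀ < ‖z‖`,
then the total charge at every point `a` with `ρ₀ < ‖a‖ < 1` vanishes. -/
theorem cluster_charge_eq_zero {ι : Type*} [Countable ι] {w b : ι → ℂ} {ρ₀ : ℝ} {g : ℂ → ℂ}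
    {c₀ : ℂ} (hρ₀ : 0 ≤ ρ₀) (hw : ∀ i, ‖w i‖ < 1)
    (hbl : Summable fun i ↦ 1 - ‖w i‖) (hb : Summable fun i ↦ ‖b i‖)
    (hg : DifferentiableOn ℂ g {z : ℂ | ρ₀ < ‖z‖})
    (heq : ∀ z : ℂ, 1 < ‖z‖ → HasSum (fun i ↦ b i / (z - w i)) (g z - c₀))
    {a : ℂ} (ha : ρ₀ < ‖a‖) (ha1 : ‖a‖ < 1) :
    ∑' i : {i // w i = a}, b i = 0 := by
  classical
  show ∑' i : ({i | w i = a} : Set ι), b i = 0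
  set s : ℂ := ∑' i : ({i | w i = a} : Set ι), b i with hs_def
  -- radii
  set r₁ : ℝ := (ρ₀ + ‖a‖) / 2 with hr₁
  have hr₁ρ : ρ₀ < r₁ := by rw [hr₁]; linarith
  have hr₁a : r₁ < ‖a‖ := by rw [hr₁]; linarith
  have hr₁0 : 0 < r₁ := lt_of_le_of_lt hρ₀ hr₁ρ
  have hr₁1 : r₁ < 1 := hr₁a.trans ha1
  have ha0 : 0 < ‖a‖ := lt_of_le_of_lt hρ₀ ha
  -- `G := g - c₀`, holomorphic on `ρ₀ < ‖z‖`
  set G : ℂ → ℂ := fun z ↦ g z - c₀ with hG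
  have hUopen : IsOpen {z : ℂ | ρ₀ < ‖z‖} := isOpen_lt continuous_const continuous_norm
  have hGd : DifferentiableOn ℂ G {z : ℂ | ρ₀ < ‖z‖} := hg.sub_const c₀
  have hGat : ∀ z : ℂ, ρ₀ < ‖z‖ → DifferentiableAt ℂ G z := fun z hz ↦
    hGd.differentiableAt (hUopen.mem_nhds hz)
  have heq' : ∀ z : ℂ, 1 < ‖z‖ → HasSum (fun i ↦ b i / (z - w i)) (G z) := heq
  -- a bound `M` for `G` on the circle `‖z‖ = r₁`
  obtain ⟨M, hM0, hM⟩ : ∃ M : ℝ, 0 ≤ M ∧ ∀ z ∈ sphere (0 : ℂ) r₁, ‖G z‖ ≤ M := by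
    have hc : ContinuousOn G (sphere (0 : ℂ) r₁) := by
      refine hGd.continuousOn.mono fun z hz ↦ ?_
      have hz' : ‖z‖ = r₁ := by simpa [hr₁0.le, abs_of_pos hr₁0] using hz
      show ρ₀ < ‖z‖
      rw [hz']; exact hr₁ρ
    obtain ⟨M, hM⟩ := (isCompact_sphere (0 : ℂ) r₁).exists_bound_of_continuousOn hc
    exact ⟨max M 0, le_max_right _ _, fun z hz ↦ (hM z hz).trans (le_max_left _ _)⟩
  -- the uniform Blaschke lower bound at `a`
  obtain ⟨c, hc0, hc⟩ := exists_prod_norm_bl_ge hw hbl ha1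
  -- summability of the paired family and its pieces (all dominated by `‖b i‖`)
  have hφw1 : ∀ (F : Finset ι) (N : ℕ) (i : ι), ‖phi w F N (w i)‖ ≤ 1 := fun F N i ↦
    (norm_phi_le hw F N (hw i).le).trans (pow_le_one₀ (norm_nonneg _) (hw i).le)
  -- MAIN ESTIMATE: for every `N` and `ε > 0`
  have main : ∀ N : ℕ, ∀ ε : ℝ, 0 < ε → c * ‖a‖ ^ N * ‖s‖ ≤ r₁ * (r₁ ^ N * M) + ε := by
    intro N ε hε
    obtain ⟨T₀, hT₀'⟩ : ∃ T₀ : Finset ι, ∑' i : {x // x ∉ T₀}, ‖b i‖ < ε :=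
      ((tendsto_tsum_compl_atTop_zero (fun i ↦ ‖b i‖)).eventually (gt_mem_nhds hε)).exists
    have hT₀ : ∑' i : ({x | x ∉ T₀} : Set ι), ‖b (i : ι)‖ < ε := hT₀'
    set F : Finset ι := T₀.filter (fun i ↦ w i ≠ a) with hF
    have hFa : ∀ i ∈ F, w i ≠ a := fun i hi ↦ (Finset.mem_filter.1 hi).2
    set φ : ℂ → ℂ := phi w F N with hφ
    -- (i) pairing identity and (ii) the bound on the small circle
    have ident : ∑' i, b i * φ (w i) = (2 * π * I)⁻¹ • ∮ z in C(0, r₁), φ z * G z :=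
      pairing_identity hρ₀ hw hb hGat heq' F N hr₁ρ hr₁1
    have rhs_bound : ‖(2 * π * I : ℂ)⁻¹ • ∮ z in C(0, r₁), φ z * G z‖ ≤ r₁ * (r₁ ^ N * M) := by
      refine circleIntegral.norm_two_pi_i_inv_smul_integral_le_of_norm_le_const hr₁0.le ?_
      intro z hz
      have hz' : ‖z‖ = r₁ := by simpa [hr₁0.le, abs_of_pos hr₁0] using hz
      rw [norm_mul]
      have h1 : ‖φ z‖ ≤ r₁ ^ N := by
        have := norm_phi_le hw F N (z := z) (by rw [hz']; exact hr₁1.le)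
        rwa [hz'] at this
      exact mul_le_mul h1 (hM z hz) (norm_nonneg _) (pow_nonneg hr₁0.le _)
    -- (iii) split the paired family: `b i φ(w i) = f₁ i + f₂ i`
    set f₁ : ι → ℂ := ({i | w i = a} : Set ι).indicator (fun i ↦ b i * φ a) with hf₁
    set f₂ : ι → ℂ := ({i | w i ≠ a ∧ i ∉ T₀} : Set ι).indicator (fun i ↦ b i * φ (w i)) with hf₂
    have hdecomp : (fun i ↦ b i * φ (w i)) = fun i ↦ f₁ i + f₂ i := by
      funext i
      simp only [hf₁, hf₂, Set.indicator_apply, Set.mem_setOf_eq]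
      by_cases h1 : w i = a
      · simp [h1]
      · by_cases h2 : i ∈ T₀
        · have hiF : i ∈ F := Finset.mem_filter.2 ⟨h2, h1⟩
          have : φ (w i) = 0 := phi_apply_eq_zero hiF
          simp [h1, h2, this]
        · simp [h1, h2]
    have hf₁s : Summable f₁ := by
      refine hb.of_norm_bounded fun i ↦ ?_
      simp only [hf₁, Set.indicator_apply, Set.mem_setOf_eq]
      split_ifs with h
      · rw [norm_mul]
        have : ‖φ a‖ ≤ 1 := (norm_phi_le hw F N ha1.le).trans (pow_le_one₀ (norm_nonneg _) ha1.le)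
        exact mul_le_of_le_one_right (norm_nonneg _) this
      · simp
    have hf₂le : ∀ i, ‖f₂ i‖ ≤ ({x | x ∉ T₀} : Set ι).indicator (fun i ↦ ‖b i‖) i := by
      intro i
      by_cases h2 : i ∈ T₀
      · have hl : f₂ i = 0 :=
          Set.indicator_of_notMem (fun h : i ∈ {i | w i ≠ a ∧ i ∉ T₀} ↦ h.2 h2) _
        have hr : ({x | x ∉ T₀} : Set ι).indicator (fun i ↦ ‖b i‖) i = 0 :=
          Set.indicator_of_notMem (fun h : i ∈ {x | x ∉ T₀} ↦ h h2) _
        rw [hl, hr, norm_zero]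
      · have hr : ({x | x ∉ T₀} : Set ι).indicator (fun i ↦ ‖b i‖) i = ‖b i‖ :=
          Set.indicator_of_mem (show i ∈ {x | x ∉ T₀} from h2) _
        rw [hr]
        by_cases h1 : w i = a
        · have hl : f₂ i = 0 :=
            Set.indicator_of_notMem (fun h : i ∈ {i | w i ≠ a ∧ i ∉ T₀} ↦ h.1 h1) _
          rw [hl, norm_zero]
          exact norm_nonneg _
        · have hl : f₂ i = b i * φ (w i) :=
            Set.indicator_of_mem (show i ∈ {i | w i ≠ a ∧ i ∉ T₀} from ⟨h1, h2⟩) _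
          rw [hl, norm_mul]
          exact mul_le_of_le_one_right (norm_nonneg _) (hφw1 F N i)
    have hind_s : Summable (({x | x ∉ T₀} : Set ι).indicator (fun i ↦ ‖b i‖)) := hb.indicator _
    have hf₂s : Summable f₂ := hind_s.of_norm_bounded hf₂le
    have hsum₁ : ∑' i, f₁ i = φ a * s := by
      have h1 : ∑' i, f₁ i = ∑' i : ({i | w i = a} : Set ι), b i * φ a := (tsum_subtype _ _).symm
      rw [h1, tsum_mul_right, mul_comm]
    have hsplit : ∑' i, b i * φ (w i) = φ a * s + ∑' i, f₂ i := by
      rw [hdecomp, (hf₁s.hasSum.add hf₂s.hasSum).tsum_eq, hsum₁]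
    have htail : ‖∑' i, f₂ i‖ ≤ ε := by
      calc ‖∑' i, f₂ i‖ ≤ ∑' i, ‖f₂ i‖ := norm_tsum_le_tsum_norm hf₂s.norm
        _ ≤ ∑' i, ({x | x ∉ T₀} : Set ι).indicator (fun i ↦ ‖b i‖) i :=
            hf₂s.norm.tsum_le_tsum hf₂le hind_s
        _ = ∑' i : ({x | x ∉ T₀} : Set ι), ‖b (i : ι)‖ := (tsum_subtype _ _).symm
        _ ≤ ε := hT₀.le
    -- (iv) combine
    have hca : c * ‖a‖ ^ N ≤ ‖φ a‖ := by
      rw [hφ, norm_phi, mul_comm]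
      exact mul_le_mul_of_nonneg_left (hc F hFa) (pow_nonneg (norm_nonneg _) _)
    calc c * ‖a‖ ^ N * ‖s‖ ≤ ‖φ a‖ * ‖s‖ := mul_le_mul_of_nonneg_right hca (norm_nonneg _)
      _ = ‖φ a * s‖ := (norm_mul _ _).symm
      _ = ‖∑' i, b i * φ (w i) - ∑' i, f₂ i‖ := by rw [hsplit, add_sub_cancel_right]
      _ ≤ ‖∑' i, b i * φ (w i)‖ + ‖∑' i, f₂ i‖ := norm_sub_le _ _
      _ ≤ r₁ * (r₁ ^ N * M) + ε := add_le_add (by rw [ident]; exact rhs_bound) htail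
  -- CONCLUSION: `c ‖a‖^N ‖s‖ ≤ r₁^{N+1} M` for all `N`, and `r₁ < ‖a‖`
  have main' : ∀ N : ℕ, c * ‖a‖ ^ N * ‖s‖ ≤ r₁ * (r₁ ^ N * M) := fun N ↦
    le_of_forall_pos_le_add fun ε hε ↦ main N ε hε
  have hθ1 : r₁ / ‖a‖ < 1 := (div_lt_one ha0).2 hr₁a
  have hθ0 : 0 ≤ r₁ / ‖a‖ := div_nonneg hr₁0.le (norm_nonneg _)
  have hsle : ∀ N : ℕ, ‖s‖ ≤ (r₁ * M / c) * (r₁ / ‖a‖) ^ N := by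
    intro N
    have h := main' N
    have haN : 0 < ‖a‖ ^ N := pow_pos ha0 N
    have hre : (r₁ * M / c) * (r₁ / ‖a‖) ^ N = r₁ * (r₁ ^ N * M) / (c * ‖a‖ ^ N) := by
      rw [div_pow]
      field_simp
    rw [hre, le_div_iff₀ (mul_pos hc0 haN)]
    calc ‖s‖ * (c * ‖a‖ ^ N) = c * ‖a‖ ^ N * ‖s‖ := by ring
      _ ≤ r₁ * (r₁ ^ N * M) := h
  have hlim : Tendsto (fun N : ℕ ↦ (r₁ * M / c) * (r₁ / ‖a‖) ^ N) atTop (𝓝 0) := by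
    have := (tendsto_pow_atTop_nhds_zero_of_lt_one hθ0 hθ1).const_mul (r₁ * M / c)
    simpa using this
  have hs0 : ‖s‖ ≤ 0 := ge_of_tendsto' hlim hsle
  exact norm_le_zero_iff.1 hs0

end Summit.RiemannHypothesis.RiemannHypothesis.Theorems.Splittings.ScrewBlaschkeRigidity
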